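import Summits.QuantumFields.BalabanUV.Beta.CombMixedT2EvenGradedPeriodised

/-!
# `BalabanUV.Beta.CombMixedT2EvenGradedTorus` — binder row D1 ∕ (C1), PART 79c: **(K2b) FOR THE GRADED TABLE ON THE TORUS, AT EVERY DEPTH, IS THE PURE COMMUTATOR** —
# for the COARSE-SLOT-PERIODISED even GRADED composite mixed table of depth `m` (box `M = Lc^m·M′`, weight `wM2 3 L₂ j` free) and every torus gauge function `λ`,
# `Σ_b (Dλ)_b • 𝓜̂ᴳ₂ᵉ⁽ᵐ⁾(b; ρ′,w)|ff = wM2 • (Ĉ⁽ᵐ⁾_{ρ′,w}·E_λ − E_λ·Ĉ⁽ᵐ⁾_{ρ′,w}) = (−wM2) • (E_λ·Ĉ⁽ᵐ⁾ − Ĉ⁽ᵐ⁾·E_λ)`, `Ĉ⁽ᵐ⁾_{ρ′,w} := perF M (dper M (compH (ctrOff 4 Lc) Lc m ρ′ w))|ff` the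
# periodised depth-`m` composite constraint Hessian, `E_λ := diagonal (λ b.1)` — PART 26's depth-1 display ONE LETTER UP (`Ĥ ↦ Ĉ⁽ᵐ⁾`), with NO site-remainder:
# road «FP» `TowerK2bDefectClosed.def_allDepths`'s `Σ_s λ s • R m ρ′ w s` is the price of F6c's `compMix`; for (F0)'s `compMixG` it is ABSENT at every depth

WHY (journal [AN2-G81-LANDED-2] INTENT-2; J-NOTE-26 §6 (2)).  PART 79b fed PART 78b's site law, 79a's covariance and the supports into the letters of the row's period-lattice
engine; this file applies the engine (PART 26 §3 verbatim with `symHessFFAt ↦ compH (ctrOff 4 Lc) Lc m`) — entrywise, then the two matrix forms, then the road's orientation.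
USE (design level, the road's call): whatever (K2b′)-type row v11 displays for `hM₂′ := compMixG` can be THIS one-line commutator at every box `n` (depth `m = n + 2`), in the
currency `TowerK2bDefectClosed` already reads (`R := 0`).

WHAT (`d = 3`, centred root, any depth `m`, any box `M = Lc^m·M′`; [folklore] re-indexing BY NAME; no `def`, no `def … : Prop`, nothing cited, 0 sorry):
**`sum_tgrad_mul_perZ_dper_compMixedT2Gper_even`** (entrywise), **`torus_M2Geven_pureGauge_fst`** (along a torus gauge parameter), **`torus_M2Geven_pureGauge_fst_fun`** (along any
torus gauge function — the display), `torus_M2Geven_pureGauge_fst_fun'` (the road's orientation `(−wM2) • (E_λ·Ĉ − Ĉ·E_λ)`).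
WHAT THIS IS NOT: not a statement about `compMix` (PART 33 ∕ road `def_allDepths` stand: its remainder `R` is genuinely there); not v11's `hM₂′` or `a2` (the road's); nothing of
Bałaban's asserted, valued or discharged (OUR two transcriptions, OUR chain rule — ABSOLUTE RULE); 0 estimates; 0∕4 row-D1 binders (hW, hR, D1Tel, D1Rep); ROOT M‴ p325680 ∕ P5c ∕
D6 untouched; NOT (C1), NOT (T-ID), NOT D1, NEVER «G-an2-4 closed», NOT BetaPertH, NOT continuum, NOT Clay.

HONEST DEPENDENCY (page 1, mandatory): continuum YM on T⁴ ⇐ BetaPertH ∧ nine spine estimates (0/9 proved); BetaPertH ⇐ (D1) ∧ (D4) ∧ CAP+tail;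
G-an2-4 gates asym, D1 and NE2/3/4.  HONEST FRAMING (cell contract, verbatim): «discharging `BetaPertH` makes Bałaban's UV stability UNCONDITIONAL —
a real constructive-QFT result; it is NOT the continuum limit and NOT the Clay problem.»  ABSOLUTE RULE (cell charter, verbatim): «No internally-minted
statement may enter as a cited fact. Every hypothesis is either kernel-proved in this package or a verbatim quotation of a PUBLISHED theorem with page
reference. The manuscript(s) under audit are NOT citable for their own disputed steps — they are the thing under adjudication; programme-internal
(2001/route/tribunal) claims are never citable.»  Row D1 ∕ (C1) OWNER an2 (b2b-balaban-beta-an2) gen 81, 2026-08-29.  Proofs = PART 26 §3's, one letter up.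
No existing file touched.
-/

noncomputable section

open scoped BigOperators

namespace Summit.QuantumFields.BalabanUV.Beta.CombMixedT2EvenGradedTorus

open Finset Matrix
open Literature.MathematicalPhysics.QuantumFieldTheory
open Literature.MathematicalPhysics.QuantumFieldTheory.Balaban1983to89
open Literature.MathematicalPhysics.QuantumFieldTheory.Balaban1983to89.Beta
open B4TorusKernel.MultiPeriod (translate translate_apply)
open B6Lemma24Torus (pbox mem_pbox)
open ExpKernelCalculus (MKer shiftK)
open AffineAveraging (Site box toSite unitVec dz)
open AveragingContoursRooted (ctr ctrOff ctrOff_mem_box)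
open AveragingHessianKernels (Bond Near)
open OneStepResolventKernel (Fib)
open BalabanStepW2 (M2Of wM2)
open Summit.QuantumFields.BalabanUV.Beta.TameKernelCalculus (trK trK_apply)
open Summit.QuantumFields.BalabanUV.Beta.BorderedHessian (sgnK sgnK_apply sgnF_inl)
open Summit.QuantumFields.BalabanUV.Beta.AxialDressingRooted (one_le_of_neZero)
open Summit.QuantumFields.BalabanUV.Beta.WardLocusParityLevels (M2Of_apply)
open Summit.QuantumFields.BalabanUV.Beta.SymAveragingHessianCounts (symLinKerAt symVhKerAt symHessKerAt)
open Summit.QuantumFields.BalabanUV.Beta.SymAveragingMixedJetTables (symMixKerAt)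
open Summit.QuantumFields.BalabanUV.Beta.CompositeVertexKernelRec (offs winF wid compLinKer compVHKer compVHKer_eq_zero_left compVHKer_eq_zero_right)
open Summit.QuantumFields.BalabanUV.Beta.CompositeVertexKernelLiftKernel (mem_piFinset_of_mem_winF)
open Summit.QuantumFields.BalabanUV.Beta.CompositeHessianTable (compHessFF_inl_inl)
open Summit.QuantumFields.BalabanUV.Beta.CompositeOneShotJets (compH compH_hHt)
open Summit.QuantumFields.BalabanUV.Beta.CompositeMixedTableGraded (compMixKerG compMixG)
open Summit.QuantumFields.BalabanUV.Beta.CompositeMixedTableGradedCov (compMixKerG_eq_zero_left compMixKerG_eq_zero_right compMixG_translate)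
open Summit.QuantumFields.BalabanUV.Beta.CombMixedT2EvenGradedLetters (compMixKerG_eq_zero_bg)
open Summit.QuantumFields.BalabanUV.Beta.CombMixedT2EvenGradedRec (tsum_sum_grad_mul_compMixKerG_even)
open Summit.QuantumFields.BalabanUV.Beta.CombMixedT2EvenStoreyTwoPeriodised (sub_mem_piFinset_of_mem_winF)
open Summit.QuantumFields.BalabanUV.Beta.GAN24.BorderGaugeLegContact (tsum_sum_dz_mul_eq)
open Summit.QuantumFields.BalabanUV.Beta.FP.KernelPeriodisationFib (Idx perF perF_apply perZ perZ_apply perZ_smul translate_eq_add)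
open Summit.QuantumFields.BalabanUV.Beta.FP.KernelPeriodisationFibLoc (dper dper_apply)
open Summit.QuantumFields.BalabanUV.Beta.FP.TorusGaugeCovariance (tdelta tgrad)
open Summit.QuantumFields.BalabanUV.Beta.FP.TorusGaugeCovariancePairing (sum_tdelta_mul wrapPt_of_mem)
open Summit.QuantumFields.BalabanUV.Beta.FP.PeriodisedBorderIndexWard (translate_injective)
open Summit.QuantumFields.BalabanUV.Beta.FP.PeriodisedBorderTables (translate_eq_add_smul)
open Summit.QuantumFields.BalabanUV.Beta.FP.PeriodisedBorderTablesRecord (dper_apply_of_siteCov)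
open Summit.QuantumFields.BalabanUV.Beta.CombWilsonT2Periodised (sum_tgrad_mul_perZ_dper_of_indexLaw_periodCov translate_eq_translate_sub_add)

variable {Lc : ℕ} [NeZero Lc]
open Summit.QuantumFields.BalabanUV.Beta.CombMixedT2EvenGradedPeriodised (compMixedT2Gper_even_periodCov compMixedT2Gper_even_inl_inl_eq_zero_of_not_mem_S
  compMixedT2Gper_even_inl_inl_eq_zero_of_not_mem_T dper_compH_inl_inl_eq_zero_of_not_mem sum_compMixedT2Gper_even_sub_inl_inl)

/-! ## §3 (K2b) for the graded table on the torus, every depth: the pure commutator with the periodised composite Hessian -/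

section Torus

variable {M M' : Fin (3 + 1) → ℕ} [∀ μ, NeZero (M μ)] [∀ μ, NeZero (M' μ)] (L₂ j m : ℕ) (ρ' : Fin (3 + 1)) (w : Site (3 + 1))
  {V : Fin (3 + 1) → Site (3 + 1) → MKer (3 + 1) (Fib 3)}

/-- [folklore] **`sum_tgrad_mul_perZ_dper_compMixedT2Gper_even` — ENTRYWISE** (the row's period-lattice engine fed §2's letters): for every torus gauge parameter `s` and `ff` entry,
`Σ_{u ∈ pbox M} Σ_κ tgrad M (u, inl κ) s · perZ M (dper M (V κ u)) x z (inl α) (inl γ) = (tdelta M x s − tdelta M z s) · perZ M ((−wM2) • dper M (compH (ctrOff 4 Lc) Lc m ρ′ w)) x z (inl α) (inl γ)`. -/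
theorem sum_tgrad_mul_perZ_dper_compMixedT2Gper_even (hM : ∀ i, M i = Lc ^ m * M' i)
    (hV : V = fun κ u x z a c => ∑' n : Site (3 + 1),
      ((1 / 2 : ℝ) • (M2Of 3 L₂ (compMixG (ctrOff (3 + 1) Lc) Lc m) j κ u ρ' (translate M' w n)
          + sgnK (trK (M2Of 3 L₂ (compMixG (ctrOff (3 + 1) Lc) Lc m) j κ u ρ' (translate M' w n))))) x z a c)
    (s : ↥(pbox M)) (x z : Site (3 + 1)) (α γ : Fin (3 + 1)) :
    ∑ u : ↥(pbox M), ∑ κ : Fin (3 + 1), tgrad M (u, Sum.inl κ) s * perZ M (dper M (V κ (u : Site (3 + 1)))) x z (Sum.inl α) (Sum.inl γ)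
      = (tdelta M x s - tdelta M z s) * perZ M ((-wM2 3 L₂ j) • dper M (compH (ctrOff (3 + 1) Lc) Lc m ρ' w)) x z (Sum.inl α) (Sum.inl γ) :=
  sum_tgrad_mul_perZ_dper_of_indexLaw_periodCov (M := M) V ((-wM2 3 L₂ j) • dper M (compH (ctrOff (3 + 1) Lc) Lc m ρ' w)) (fun x => x)
    (fun x => (Fintype.piFinset fun _ : Fin (3 + 1) => Finset.Icc (-(wid Lc m : ℤ)) (wid Lc m : ℤ)).image (fun v => x - v))
    (fun x => (Fintype.piFinset fun _ : Fin (3 + 1) => Finset.Icc (-(wid Lc m : ℤ)) (wid Lc m : ℤ)).image (fun v => x - v)) (Sum.inl α) (Sum.inl γ)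
    (compMixedT2Gper_even_periodCov L₂ j m ρ' w hM hV) (fun κ u x => compMixedT2Gper_even_inl_inl_eq_zero_of_not_mem_S L₂ j m ρ' w hV κ u x α γ)
    (fun κ x z => compMixedT2Gper_even_inl_inl_eq_zero_of_not_mem_T L₂ j m ρ' w hV κ x z α γ)
    (fun x => dper_compH_inl_inl_eq_zero_of_not_mem m ρ' w hM (-wM2 3 L₂ j) x α γ)
    (fun w₀ x z => sum_compMixedT2Gper_even_sub_inl_inl L₂ j m ρ' w hM hV w₀ x z α γ) s x z

/-- [folklore] **`torus_M2Geven_pureGauge_fst` — MATRIX FORM ON THE `ff` BLOCK, ANY DEPTH `m`, ANY BOX `M = Lc^m·M′`**: with the torus even graded bi-member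
`𝓜ᴳ₂ᵉ^{b,β} := (perF M (dper M (V b.2 ↑b.1)))|ff` and the periodised depth-`m` composite Hessian `Ĉ_β := (perF M (dper M (compH (ctrOff 4 Lc) Lc m ρ′ w)))|ff`, for every torus gauge parameter `s`:
`Σ_b tgrad M (b.1, inl b.2) s • 𝓜ᴳ₂ᵉ^{b,β} = wM2 • (Ĉ_β * E_s − E_s * Ĉ_β)`, `E_s := diagonal (tdelta M b.1 s)` — a PURE commutator, no remainder, at every depth. -/
theorem torus_M2Geven_pureGauge_fst (hM : ∀ i, M i = Lc ^ m * M' i)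
    (hV : V = fun κ u x z a c => ∑' n : Site (3 + 1),
      ((1 / 2 : ℝ) • (M2Of 3 L₂ (compMixG (ctrOff (3 + 1) Lc) Lc m) j κ u ρ' (translate M' w n)
          + sgnK (trK (M2Of 3 L₂ (compMixG (ctrOff (3 + 1) Lc) Lc m) j κ u ρ' (translate M' w n))))) x z a c)
    (s : ↥(pbox M)) :
    (∑ b : ↥(pbox M) × Fin (3 + 1), tgrad M (b.1, Sum.inl b.2) s •
        (perF M (dper M (V b.2 (b.1 : Site (3 + 1))))).submatrix
          (fun b : ↥(pbox M) × Fin (3 + 1) => ((b.1, Sum.inl b.2) : Idx M (Fib 3)))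
          (fun b : ↥(pbox M) × Fin (3 + 1) => ((b.1, Sum.inl b.2) : Idx M (Fib 3))))
      = wM2 3 L₂ j • ((perF M (dper M (compH (ctrOff (3 + 1) Lc) Lc m ρ' w))).submatrix
            (fun b : ↥(pbox M) × Fin (3 + 1) => ((b.1, Sum.inl b.2) : Idx M (Fib 3)))
            (fun b : ↥(pbox M) × Fin (3 + 1) => ((b.1, Sum.inl b.2) : Idx M (Fib 3)))
          * Matrix.diagonal (fun b : ↥(pbox M) × Fin (3 + 1) => tdelta M (b.1 : Site (3 + 1)) s)
        - Matrix.diagonal (fun b : ↥(pbox M) × Fin (3 + 1) => tdelta M (b.1 : Site (3 + 1)) s)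
          * (perF M (dper M (compH (ctrOff (3 + 1) Lc) Lc m ρ' w))).submatrix
            (fun b : ↥(pbox M) × Fin (3 + 1) => ((b.1, Sum.inl b.2) : Idx M (Fib 3)))
            (fun b : ↥(pbox M) × Fin (3 + 1) => ((b.1, Sum.inl b.2) : Idx M (Fib 3)))) := by
  ext x z
  rw [Matrix.sum_apply, Matrix.smul_apply, Matrix.sub_apply, Matrix.diagonal_mul, Matrix.mul_diagonal, smul_eq_mul]
  simp only [Matrix.smul_apply, Matrix.submatrix_apply, perF_apply, smul_eq_mul]
  rw [Fintype.sum_prod_type, sum_tgrad_mul_perZ_dper_compMixedT2Gper_even (M := M) (M' := M') L₂ j m ρ' w hM hV s _ _ x.2 z.2, perZ_smul]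
  simp only [Pi.smul_apply, smul_eq_mul]
  ring

/-- [folklore] **`torus_M2Geven_pureGauge_fst_fun` — ALONG ANY TORUS GAUGE FUNCTION** `λ : ↥(pbox M) → ℝ` (`(Dλ)_b := Σ_s tgrad M (b.1, inl b.2) s · λ s`), every depth `m`:
`Σ_b (Dλ)_b • 𝓜ᴳ₂ᵉ^{b,β} = wM2 • (Ĉ_β * E_λ − E_λ * Ĉ_β)`, `E_λ := diagonal (fun b => λ b.1)` — PART 26's (K2b) display with `Ĥ_β ↦ Ĉ⁽ᵐ⁾_β`. -/
theorem torus_M2Geven_pureGauge_fst_fun (hM : ∀ i, M i = Lc ^ m * M' i)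
    (hV : V = fun κ u x z a c => ∑' n : Site (3 + 1),
      ((1 / 2 : ℝ) • (M2Of 3 L₂ (compMixG (ctrOff (3 + 1) Lc) Lc m) j κ u ρ' (translate M' w n)
          + sgnK (trK (M2Of 3 L₂ (compMixG (ctrOff (3 + 1) Lc) Lc m) j κ u ρ' (translate M' w n))))) x z a c)
    (lam : ↥(pbox M) → ℝ) :
    (∑ b : ↥(pbox M) × Fin (3 + 1), (∑ s : ↥(pbox M), tgrad M (b.1, Sum.inl b.2) s * lam s) •
        (perF M (dper M (V b.2 (b.1 : Site (3 + 1))))).submatrix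
          (fun b : ↥(pbox M) × Fin (3 + 1) => ((b.1, Sum.inl b.2) : Idx M (Fib 3)))
          (fun b : ↥(pbox M) × Fin (3 + 1) => ((b.1, Sum.inl b.2) : Idx M (Fib 3))))
      = wM2 3 L₂ j • ((perF M (dper M (compH (ctrOff (3 + 1) Lc) Lc m ρ' w))).submatrix
            (fun b : ↥(pbox M) × Fin (3 + 1) => ((b.1, Sum.inl b.2) : Idx M (Fib 3)))
            (fun b : ↥(pbox M) × Fin (3 + 1) => ((b.1, Sum.inl b.2) : Idx M (Fib 3)))
          * Matrix.diagonal (fun b : ↥(pbox M) × Fin (3 + 1) => lam b.1)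
        - Matrix.diagonal (fun b : ↥(pbox M) × Fin (3 + 1) => lam b.1)
          * (perF M (dper M (compH (ctrOff (3 + 1) Lc) Lc m ρ' w))).submatrix
            (fun b : ↥(pbox M) × Fin (3 + 1) => ((b.1, Sum.inl b.2) : Idx M (Fib 3)))
            (fun b : ↥(pbox M) × Fin (3 + 1) => ((b.1, Sum.inl b.2) : Idx M (Fib 3)))) := by
  have hswap : (∑ b : ↥(pbox M) × Fin (3 + 1), (∑ s : ↥(pbox M), tgrad M (b.1, Sum.inl b.2) s * lam s) •
        (perF M (dper M (V b.2 (b.1 : Site (3 + 1))))).submatrix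
          (fun b : ↥(pbox M) × Fin (3 + 1) => ((b.1, Sum.inl b.2) : Idx M (Fib 3)))
          (fun b : ↥(pbox M) × Fin (3 + 1) => ((b.1, Sum.inl b.2) : Idx M (Fib 3))))
      = ∑ s : ↥(pbox M), lam s • ∑ b : ↥(pbox M) × Fin (3 + 1), tgrad M (b.1, Sum.inl b.2) s •
        (perF M (dper M (V b.2 (b.1 : Site (3 + 1))))).submatrix
          (fun b : ↥(pbox M) × Fin (3 + 1) => ((b.1, Sum.inl b.2) : Idx M (Fib 3)))
          (fun b : ↥(pbox M) × Fin (3 + 1) => ((b.1, Sum.inl b.2) : Idx M (Fib 3))) := by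
    simp only [Finset.sum_smul, Finset.smul_sum, smul_smul, mul_comm (lam _)]
    exact Finset.sum_comm
  rw [hswap, Finset.sum_congr rfl fun s _ => by rw [torus_M2Geven_pureGauge_fst L₂ j m ρ' w hM hV s]]
  ext x z
  simp only [Matrix.sum_apply, Matrix.smul_apply, Matrix.sub_apply, Matrix.diagonal_mul, Matrix.mul_diagonal, smul_eq_mul]
  rw [show lam z.1 = ∑ s : ↥(pbox M), tdelta M ((z.1 : ↥(pbox M)) : Site (3 + 1)) s * lam s by rw [sum_tdelta_mul, wrapPt_of_mem],
    show lam x.1 = ∑ s : ↥(pbox M), tdelta M ((x.1 : ↥(pbox M)) : Site (3 + 1)) s * lam s by rw [sum_tdelta_mul, wrapPt_of_mem]]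
  simp only [Finset.mul_sum, Finset.sum_mul, mul_sub, Finset.sum_sub_distrib]
  congr 1 <;> exact Finset.sum_congr rfl fun s _ => by ring

/-- [folklore] **THE ROAD's ORIENTATION** (road «FP» `TowerK2bDefectClosed.def_allDepths`'s left side, with the site-remainder `R := 0`): for the GRADED table,
`Σ_b (Dλ)_b • 𝓜ᴳ₂ᵉ^{b,β} = (−wM2) • (E_λ * Ĉ_β − Ĉ_β * E_λ)` — no `Σ_s λ s • R m ρ′ w s` term at any depth. -/
theorem torus_M2Geven_pureGauge_fst_fun' (hM : ∀ i, M i = Lc ^ m * M' i)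
    (hV : V = fun κ u x z a c => ∑' n : Site (3 + 1),
      ((1 / 2 : ℝ) • (M2Of 3 L₂ (compMixG (ctrOff (3 + 1) Lc) Lc m) j κ u ρ' (translate M' w n)
          + sgnK (trK (M2Of 3 L₂ (compMixG (ctrOff (3 + 1) Lc) Lc m) j κ u ρ' (translate M' w n))))) x z a c)
    (lam : ↥(pbox M) → ℝ) :
    (∑ b : ↥(pbox M) × Fin (3 + 1), (∑ s : ↥(pbox M), tgrad M (b.1, Sum.inl b.2) s * lam s) •
        (perF M (dper M (V b.2 (b.1 : Site (3 + 1))))).submatrix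
          (fun b : ↥(pbox M) × Fin (3 + 1) => ((b.1, Sum.inl b.2) : Idx M (Fib 3)))
          (fun b : ↥(pbox M) × Fin (3 + 1) => ((b.1, Sum.inl b.2) : Idx M (Fib 3))))
      = (-(wM2 3 L₂ j)) • (Matrix.diagonal (fun b : ↥(pbox M) × Fin (3 + 1) => lam b.1)
            * (perF M (dper M (compH (ctrOff (3 + 1) Lc) Lc m ρ' w))).submatrix
                (fun b : ↥(pbox M) × Fin (3 + 1) => ((b.1, Sum.inl b.2) : Idx M (Fib 3)))
                (fun b : ↥(pbox M) × Fin (3 + 1) => ((b.1, Sum.inl b.2) : Idx M (Fib 3)))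
          - (perF M (dper M (compH (ctrOff (3 + 1) Lc) Lc m ρ' w))).submatrix
                (fun b : ↥(pbox M) × Fin (3 + 1) => ((b.1, Sum.inl b.2) : Idx M (Fib 3)))
                (fun b : ↥(pbox M) × Fin (3 + 1) => ((b.1, Sum.inl b.2) : Idx M (Fib 3)))
            * Matrix.diagonal (fun b : ↥(pbox M) × Fin (3 + 1) => lam b.1)) := by
  rw [torus_M2Geven_pureGauge_fst_fun L₂ j m ρ' w hM hV lam, neg_smul, ← smul_neg, neg_sub]

end Torus

end Summit.QuantumFields.BalabanUV.Beta.CombMixedT2EvenGradedTorus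

end
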